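import Summits.PneNP.PneNP.Theorems.ChebyshevTracialDesignCrossingPlaneConditional
import Literature.Combinatorics.Optimization.ShellLawTail
import HarnessLib

/-!
# Cell pnp-psdrank, route `ChebyshevTracialDesign`: (CG_1′) IN THE CROSSING PLANE, CONDITIONAL ON [BULK] ONLY — brick 122 ∘ the
# shell-measure Hoeffding tail (`ShellLawTail.sum_sdiff_sum_levels_shellLaw_le`) (crux `TracialDecayExp20`, stmt-PneNP-19878)

Brick 123 (prover g23; MEMO-26 §7). Brick 122 `crossingPlane_value_le_of_relSmooth` bounds the tilted (CG_1′) value of a nonnegative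
block statistic in every crossing-plane direction, per matching, by brick 120's seven pure remainders plus `2^{D+1}·9t²G` times the TAIL
MASS of the `D+1` level laws outside any relatively level-smooth window `B`. Literature `ShellLawTail` (lit g34: Hoeffding's inequality
transferred to the shell measure by the method of types) prices that tail mass for the deviation window `B_ε = {x : |x − t|H|/n| < ε}`:
`Σ_{x∈[0,t]∖B_ε} Σ_{j≤D} law_{2j+1}(x) ≤ (D+1)·2(n/2+1)³·e^{−ε²/|H|}`. Hence

* **`crossingPlane_value_le_of_relSmooth_window`**: under the hypotheses of brick 120 with `0 ≤ ψ ≤ G` on `[0,t]`, for every `ε ≥ 0`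
  such that the shell laws are relatively level-smooth at every `x ∈ [0,t]` with `|x − t|H|/n| < ε` (the [BULK] input, MEMO-26 §7
  Steps 1–6), `|PM|·Σ_U W(U,M)ψ(|U∩H|)C_u(U)² ≤ R + 2^{D+1}·9t²G·(D+1)·2(n/2+1)³·e^{−ε²/|H|}`.
READING: with `ε = K√(|H|·D)` the tail is `e^{−K²D}` against the `2^{D+1}` — the crossing-plane (CG_1′) at `e^{−a′D}` per matching is now
conditional on the SINGLE analytic input [BULK] (pointwise relative level-smoothness on the `K√(nD)` window), whose component toolkit is in
the tree (`PoissonBinomialTilting`, `PoissonBinomialChernoff`, `ShellLawDeletionComparability`, `LevelZeroShellLawTail`). WHAT THIS FILE DOES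
NOT DO: discharge [BULK]; directions outside the crossing plane; anything on `TracialDecayExp20` itself, psd rank of P_PM(K_n), or P vs NP.
[cite: Rothvoss2017, §2 (PDF p. 6)] [cite: Hoeffding1963, Thm. 2] [cite: Agarwal2000DifferenceEquations, Thm. 1.8.5 (1.8.6), Remark 1.8.1 (1.8.8)]
Stature: support/instrument (kernel lane, no defs, axioms standard). Supports stmt-PneNP-19878.
-/

set_option linter.dupNamespace false -- `Summit.PneNP.PneNP.…`: summit = sub-problem (D-0017)

noncomputable section

namespace Summit.PneNP.PneNP.Theorems.ChebyshevTracialDesignCrossingPlaneBulkConditional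

open Finset Polynomial Literature.Barriers.PneNP Literature.Combinatorics.Optimization
open Literature.Combinatorics.Optimization.ShellStep
open Summit.PneNP.PneNP.Theorems.ChebyshevTracialDesignCrossingPlaneConditional (crossingPlane_value_le_of_relSmooth)

variable {n : ℕ}

/-- **(CG_1′) in the crossing plane, conditional on [BULK] only (brick 123 = brick 122 ∘ `ShellLawTail`).** Under the hypotheses
of brick 120 with `0 ≤ ψ ≤ G` on `[0,t]` (`t = t₁ + 2(D+1) + 2`) and `ε ≥ 0` such that the shell laws of `|U∩H|` are relatively
level-smooth at every `x ∈ [0,t]` with `|x − t|H|/n| < ε`: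
`|PM|·Σ_U W(U,M)·ψ(|U∩H|)·(Σ_p u_p x_p x_{πp})² ≤ R + 2^{D+1}·9t²G·((D+1)·2(n/2+1)³·e^{−ε²/|H|})`, `R` = brick 120's seven remainders.
[cite: Rothvoss2017, §2 (PDF p. 6)] [cite: Hoeffding1963, Thm. 2] -/
theorem crossingPlane_value_le_of_relSmooth_window {t₁ T D : ℕ} {Bv : ℝ} {C : Finset ℕ} {w : ℕ → ℝ}
    (hdes : IsExactDesign n (t₁ + 2 * (D + 1) + 2) T D Bv C w) (hDT : 2 * D + 1 ≤ T) (M : PMatch n)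
    (H : Finset (Fin n)) (ψ : ℤ → ℝ) {G : ℝ} (hG0 : 0 ≤ G)
    (hG : ∀ x ∈ Icc (0 : ℤ) ((t₁ + 2 * (D + 1) + 2 : ℕ) : ℤ), |ψ x| ≤ G)
    (lam kap : ℝ) (hlam : |lam| ≤ 1) (hkap : |kap| ≤ 1)
    {m : ℕ} (hm : 3 ≤ m) (hmn : m + 4 * (D + 1) + 4 ≤ n) (X : ℕ → ℝ) (hX0 : ∀ k, 0 ≤ X k)
    (hX : ∀ k, k ≤ D + 1 → ∀ e, e ≤ 2 → ∀ c' : ℕ, c' + 2 * k ≤ T → ∀ S' : Finset (Fin n), (∀ u ∈ S', M.2.partner u ∈ S') →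
      S'.card + 4 * k + 2 * e = n →
      ∑ x ∈ Icc (0 : ℤ) ((t₁ + 2 * (D + 1) + 2 - e : ℕ) : ℤ),
        |nab2^[k] (fun c x => shellLaw M.2.partner S' H (t₁ + 2 * (D + 1) + 2 - e - 2 * k) c x : Profile) c' x| ≤ X k)
    (hψ0 : ∀ x ∈ Icc (0 : ℤ) ((t₁ + 2 * (D + 1) + 2 : ℕ) : ℤ), 0 ≤ ψ x)
    {ε : ℝ} (hε : 0 ≤ ε)
    (hbulk : ∀ x ∈ Icc (0 : ℤ) ((t₁ + 2 * (D + 1) + 2 : ℕ) : ℤ),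
      |(x : ℝ) - ((t₁ + 2 * (D + 1) + 2 : ℕ) : ℝ) * H.card / n| < ε →
      ∑ k ∈ Ico 1 (D + 1), (((2 * k).choose k : ℕ) : ℝ) / (4 : ℝ) ^ k *
        |(fwdDiff (1 : ℕ))^[k] (fun j => shellLaw M.2.partner univ H (t₁ + 2 * (D + 1) + 2) (2 * j + 1) x) 0| ≤
          shellLaw M.2.partner univ H (t₁ + 2 * (D + 1) + 2) 1 x) :
    (Fintype.card (PMatch n) : ℝ) * ∑ U : OddSet n, levelWeight n (t₁ + 2 * (D + 1) + 2) C w U M *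
        (ψ ((U.1 ∩ H).card : ℤ) *
          (∑ p : Fin n, (lam * ((if (p ∈ H ∧ M.2.partner p ∈ H) then (1 : ℝ) else 0) -
              (if (p ∉ H ∧ M.2.partner p ∉ H) then (1 : ℝ) else 0)) + (lam + kap)) *
            ((if p ∈ U.1 then (1 : ℝ) else 0) * (if M.2.partner p ∈ U.1 then (1 : ℝ) else 0))) ^ 2) ≤
      (-- R₀
      Bv * ((((T - 1) / 2).choose (D + 1) : ℕ) : ℝ) *
          ((9 * ((t₁ + 2 * (D + 1) + 2 : ℕ) : ℝ) ^ 2 * G) * (((m : ℝ) / (4 * ((m : ℝ) - 2))) ^ (D + 1) * X (D + 1))) +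
      -- 2 R₁
      2 * ((2 * (D : ℝ) + 1) * ((((2 * D).choose D : ℕ) : ℝ) / (4 : ℝ) ^ D) *
            ((3 * ((t₁ + 2 * (D + 1) + 2 : ℕ) : ℝ) * G) * (((m : ℝ) / (4 * ((m : ℝ) - 2))) ^ D * X D)) +
          Bv * ((((T - 1) / 2).choose (D + 1) : ℕ) : ℝ) *
            ((T : ℝ) * ((3 * ((t₁ + 2 * (D + 1) + 2 : ℕ) : ℝ) * G) * (((m : ℝ) / (4 * ((m : ℝ) - 2))) ^ (D + 1) * X (D + 1))) +
              2 * ((D : ℝ) + 1) * ((3 * ((t₁ + 2 * (D + 1) + 2 : ℕ) : ℝ) * G) * (((m : ℝ) / (4 * ((m : ℝ) - 2))) ^ D * X D)))) +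
      -- R₂
      ((2 * (D : ℝ) + 1) * ((((2 * D).choose D : ℕ) : ℝ) / (4 : ℝ) ^ D) *
          ((T : ℝ) * (G * (((m : ℝ) / (4 * ((m : ℝ) - 2))) ^ D * X D)) +
            2 * (D : ℝ) * (G * (((m : ℝ) / (4 * ((m : ℝ) - 2))) ^ (D - 1) * X (D - 1)))) +
        Bv * ((((T - 1) / 2).choose (D + 1) : ℕ) : ℝ) *
          ((T : ℝ) * ((T : ℝ) * (G * (((m : ℝ) / (4 * ((m : ℝ) - 2))) ^ (D + 1) * X (D + 1))) +
              2 * ((D : ℝ) + 1) * (G * (((m : ℝ) / (4 * ((m : ℝ) - 2))) ^ D * X D))) +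
            2 * ((D : ℝ) + 1) * ((T : ℝ) * (G * (((m : ℝ) / (4 * ((m : ℝ) - 2))) ^ D * X D)) +
              2 * (D : ℝ) * (G * (((m : ℝ) / (4 * ((m : ℝ) - 2))) ^ (D - 1) * X (D - 1)))))) +
      -- 4 R₃
      4 * ((2 * (D : ℝ) + 1) * ((((2 * D).choose D : ℕ) : ℝ) / (4 : ℝ) ^ D) *
            (((H.card : ℝ) / n) * ((3 * ((t₁ + 2 * (D + 1) + 2 : ℕ) : ℝ) * G) * (((m : ℝ) / (4 * ((m : ℝ) - 2))) ^ D * X D))) +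
          Bv * ((((T - 1) / 2).choose (D + 1) : ℕ) : ℝ) *
            ((T : ℝ) * (((H.card : ℝ) / n) * ((3 * ((t₁ + 2 * (D + 1) + 2 : ℕ) : ℝ) * G) *
                (((m : ℝ) / (4 * ((m : ℝ) - 2))) ^ (D + 1) * X (D + 1)))) +
              2 * ((D : ℝ) + 1) * (((H.card : ℝ) / n) * ((3 * ((t₁ + 2 * (D + 1) + 2 : ℕ) : ℝ) * G) *
                (((m : ℝ) / (4 * ((m : ℝ) - 2))) ^ D * X D))))) +
      -- 4 R₄
      4 * ((2 * (D : ℝ) + 1) * ((((2 * D).choose D : ℕ) : ℝ) / (4 : ℝ) ^ D) *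
            ((T : ℝ) * (((H.card : ℝ) / n) * (G * (((m : ℝ) / (4 * ((m : ℝ) - 2))) ^ D * X D))) +
              2 * (D : ℝ) * (((H.card : ℝ) / n) * (G * (((m : ℝ) / (4 * ((m : ℝ) - 2))) ^ (D - 1) * X (D - 1))))) +
          Bv * ((((T - 1) / 2).choose (D + 1) : ℕ) : ℝ) *
            ((T : ℝ) * ((T : ℝ) * (((H.card : ℝ) / n) * (G * (((m : ℝ) / (4 * ((m : ℝ) - 2))) ^ (D + 1) * X (D + 1)))) +
                2 * ((D : ℝ) + 1) * (((H.card : ℝ) / n) * (G * (((m : ℝ) / (4 * ((m : ℝ) - 2))) ^ D * X D)))) +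
              2 * ((D : ℝ) + 1) * ((T : ℝ) * (((H.card : ℝ) / n) * (G * (((m : ℝ) / (4 * ((m : ℝ) - 2))) ^ D * X D))) +
                2 * (D : ℝ) * (((H.card : ℝ) / n) * (G * (((m : ℝ) / (4 * ((m : ℝ) - 2))) ^ (D - 1) * X (D - 1))))))) +
      -- 4 R₅
      4 * ((2 * (D : ℝ) + 1) * ((((2 * D).choose D : ℕ) : ℝ) / (4 : ℝ) ^ D) *
            (((H.card : ℝ) / n) * (G * (((m : ℝ) / (4 * ((m : ℝ) - 2))) ^ D * X D))) +
          Bv * ((((T - 1) / 2).choose (D + 1) : ℕ) : ℝ) *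
            ((T : ℝ) * (((H.card : ℝ) / n) * (G * (((m : ℝ) / (4 * ((m : ℝ) - 2))) ^ (D + 1) * X (D + 1)))) +
              2 * ((D : ℝ) + 1) * (((H.card : ℝ) / n) * (G * (((m : ℝ) / (4 * ((m : ℝ) - 2))) ^ D * X D))))) +
      -- 4 R₆
      4 * ((2 * (D : ℝ) + 1) * ((((2 * D).choose D : ℕ) : ℝ) / (4 : ℝ) ^ D) *
            (((H.card : ℝ) ^ 2 / ((n : ℝ) * ((n : ℝ) - 2))) * (G * ((T : ℝ) * (((m : ℝ) / (4 * ((m : ℝ) - 2))) ^ D * X D) +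
              2 * (D : ℝ) * (((m : ℝ) / (4 * ((m : ℝ) - 2))) ^ (D - 1) * X (D - 1))))) +
          Bv * ((((T - 1) / 2).choose (D + 1) : ℕ) : ℝ) *
            ((T : ℝ) * (((H.card : ℝ) ^ 2 / ((n : ℝ) * ((n : ℝ) - 2))) *
                (G * ((T : ℝ) * (((m : ℝ) / (4 * ((m : ℝ) - 2))) ^ (D + 1) * X (D + 1)) +
                  2 * ((D : ℝ) + 1) * (((m : ℝ) / (4 * ((m : ℝ) - 2))) ^ D * X D)))) +
              2 * ((D : ℝ) + 1) * (((H.card : ℝ) ^ 2 / ((n : ℝ) * ((n : ℝ) - 2))) *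
                (G * ((T : ℝ) * (((m : ℝ) / (4 * ((m : ℝ) - 2))) ^ D * X D) +
                  2 * (D : ℝ) * (((m : ℝ) / (4 * ((m : ℝ) - 2))) ^ (D - 1) * X (D - 1)))))))) +
      (2 : ℝ) ^ (D + 1) * (9 * ((t₁ + 2 * (D + 1) + 2 : ℕ) : ℝ) ^ 2 * G) *
        (((D : ℝ) + 1) * (2 * ((n : ℝ) / 2 + 1) ^ 3 * Real.exp (-(ε ^ 2 / H.card)))) := by
  let B : Finset ℤ := (Icc (0 : ℤ) ((t₁ + 2 * (D + 1) + 2 : ℕ) : ℤ)).filter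
    (fun x : ℤ => |(x : ℝ) - ((t₁ + 2 * (D + 1) + 2 : ℕ) : ℝ) * H.card / n| < ε)
  have hB : B ⊆ Icc (0 : ℤ) ((t₁ + 2 * (D + 1) + 2 : ℕ) : ℤ) := filter_subset _ _
  have hbulkB : ∀ x ∈ B, ∑ k ∈ Ico 1 (D + 1), (((2 * k).choose k : ℕ) : ℝ) / (4 : ℝ) ^ k *
      |(fwdDiff (1 : ℕ))^[k] (fun j => shellLaw M.2.partner univ H (t₁ + 2 * (D + 1) + 2) (2 * j + 1) x) 0| ≤
        shellLaw M.2.partner univ H (t₁ + 2 * (D + 1) + 2) 1 x :=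
    fun x hx => hbulk x (mem_filter.1 hx).1 (mem_filter.1 hx).2
  have h122 := crossingPlane_value_le_of_relSmooth hdes hDT M H ψ hG0 hG lam kap hlam hkap hm hmn X hX0 hX hψ0 B hB hbulkB
  -- the tail mass outside the window, by the shell-measure Hoeffding bound
  have hπ : ∀ v, M.2.partner (M.2.partner v) = v := partner_partner M
  have hπ' : ∀ v, M.2.partner v ≠ v := partner_ne M
  have htail := sum_sdiff_sum_levels_shellLaw_le hπ hπ' H (t₁ + 2 * (D + 1) + 2) D hε
    (Icc (0 : ℤ) ((t₁ + 2 * (D + 1) + 2 : ℕ) : ℤ)) B (fun x hx => by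
      have h := mem_sdiff.1 hx
      have : ¬ |(x : ℝ) - ((t₁ + 2 * (D + 1) + 2 : ℕ) : ℝ) * H.card / n| < ε :=
        fun hlt => h.2 (mem_filter.2 ⟨h.1, hlt⟩)
      exact not_lt.1 this)
  have hc : 0 ≤ (2 : ℝ) ^ (D + 1) * (9 * ((t₁ + 2 * (D + 1) + 2 : ℕ) : ℝ) ^ 2 * G) := by positivity
  have hmul := mul_le_mul_of_nonneg_left htail hc
  linarith [h122, hmul]

end Summit.PneNP.PneNP.Theorems.ChebyshevTracialDesignCrossingPlaneBulkConditional
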